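import Mathlib
import Summits.ValiantsHypothesis.ValiantsHypothesis.Theorems.NewtonUnitEquationsDissociatedUniformTotalsLawUnion
import Summits.ValiantsHypothesis.ValiantsHypothesis.Theorems.NewtonUnitEquationsDissociatedUniformTotalsLawUnionVertBound
import Summits.ValiantsHypothesis.ValiantsHypothesis.Theorems.NewtonUnitEquationsDissociatedUniformTotalsLawUnionConverse
import Summits.ValiantsHypothesis.ValiantsHypothesis.Theorems.NewtonUnitEquationsDissociatedUniformTotalsLawUnionVertLowerGrid
import Summits.ValiantsHypothesis.ValiantsHypothesis.Theorems.NewtonUnitEquationsDissociatedUniformTotalsLawUnionVertLowerCluster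
import Summits.ValiantsHypothesis.ValiantsHypothesis.Theorems.NewtonUnitEquationsDissociatedUniformTotalsLawUnionVertLowerCert
import HarnessLib

/-!
# Crux `NewtonUnitEquations.DissociatedUniform` (stmt-ValiantsHypothesis-5905): the pointwise union vertex bound is FALSE —
# part 4/4, `∀ C, ¬ UnionVertBound C` and the exponent `4/3`

`…TotalsLawUnionVertBound` typed the located pointwise rung `@[conjecture] UnionVertBound C`: for every finite abelian `G`,
all `a b : G → ℝ²`, every position set `Z` and class `s`, `#vert conv U_s(Z) ≤ C·|G|` (`U_s(Z) = ⋃_{z∈Z} P_{s-z}`, the union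
of fibres of the pair sumset `A + B`), with census `max = 3q − 1` for `q = 4,…,9` and the recommendation "prove
`UnionVertBound 3`" (memos NOTES-t1g11 §2/§6, NOTES-t1g12 §4).  THIS FILE REFUTES IT FOR EVERY `C`:
* `not_unionVertBound : ∀ C, ¬ UnionVertBound C`;
* `UVBCex.four_mul_pow_le_unionVert : 4m⁴ ≤ #vert conv U_0(Z)` on the family of parts 1–2 (`|G| = 16m³`), hence
  `UVBCex.card_pow_four_le_unionVert_cube : |G|⁴ ≤ 1024·(#vert conv U_0(Z))³` — the pointwise count reaches
  `|G|^{4/3}/10.08`, the exponent of the Eisenbrand–Pach–Rothvoß–Sopher upper bound `48|G|^{4/3}` of `…TotalsLawUnionEPRS`: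
  THE POINTWISE UNION HULL OF SUMSET FIBRES IS `Θ(|G|^{4/3})` — the fibre structure buys nothing pointwise over general
  convexly independent subsets of `A + B`;
* `exists_unionVert_gt` (unfolded form) and `UVBCex.unionVert_gt` (`C·|G| < #vert` at `m = 4C + 1`).
Mechanism (exact numerics in memo `Cruxes/DissociatedUniform/NOTES-t1g13.md`: `V/q = 3.08, 3.73, 4.39` at `q = 729, 1331,
2197`): `B` is a projective image of the `k × 2k²` grid relabelled along the parabola `j ↦ j + i(i+k)`, so that EVERY
translate of the anti-parabola position set is a rich grid LINE of its own slope carrying the rest of its cluster on one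
side (part 2, `col_row_of_lt/ge`); the projective map makes the `≈ k³` parallel-class lines pairwise non-parallel (slopes
`2uP/(P + ĉ)`, part 1 `param_sep`), the convexification `Y + X²/M` makes each line strictly convex outward with an exact
concave-quadratic score (part 1 `gval_chain`), and the far parabola `A` gives every cluster its private window of directions
(part 1 `apt_gap`).  Each of the `4m⁴` grid points `(j, 2uj + c)`, `1 ≤ u ≤ m`, `c < 4m²`, `m ≤ j < 2m`, is then the STRICT
top of `U_0(Z)` for the weight `(2uP/(P+c) + 2X_j/M, -1)` (`strict_top`), hence a hull vertex
(`IsStrictTop.mem_extremePoints` of the tree), and they are pairwise distinct (part 3, `strict_top`, `vOf_injOn`).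
Consequences for the programme: the by-name implications `unionTotalsLaw_of_unionVertBound`,
`twoValuedTotalsLaw_of_unionVertBound`, `convexUnionVertBound_of_unionVertBound`, `averageUnionBound_of_unionVertBound` are
now vacuous; `UnionTotalsLaw C` (a sum over the `|G|` translates — here only ONE translate per cluster line is large, and the
family's union total stays `≤ 3|G|²`), `AverageUnionBound` (PROVED, t1g12), `FibreLevelBound` and `ConvexUnionVertBound`
(convexly ordered stratum; Tiwary / Skomra–Thomassé give `Θ(q log q)` for convex subsets there) are NOT refuted.
Honest label: refutation of a located conjecture-grade rung by name; `UnionTotalsLaw`, `TwoValuedTotalsLaw`, `TotalsLawThree`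
remain OPEN; nothing here bears on VP ≠ VNP.
[folklore: strict linear maximisers of a finite planar set are hull vertices]
-/

set_option linter.dupNamespace false -- `ValiantsHypothesis.ValiantsHypothesis` (summit = problem) in every name

namespace Summit.ValiantsHypothesis.ValiantsHypothesis.Theorems.NewtonUnitEquationsDissociatedUniform

namespace TotalsLaw

namespace UVBCex

open scoped BigOperators Pointwise

variable (m : ℕ) [NeZero m]

/-! ### The count and the refutation -/

/-- **`4m⁴ ≤ #vert conv U_0(Z)`** for the family of parameter `m`. -/
theorem four_mul_pow_le_unionVert : 4 * m ^ 4 ≤ unionVert (aC m) (bC m) (Zset m) 0 := by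
  classical
  have hfin : ((convexHull ℝ (unionPts (aC m) (bC m) (Zset m) 0)).extremePoints ℝ).Finite :=
    (unionPts_finite (aC m) (bC m) _ 0).subset extremePoints_convexHull_subset
  have hsub : (((Idx m).image (vOf m) : Finset (Fin 2 → ℝ)) : Set (Fin 2 → ℝ)) ⊆
      (convexHull ℝ (unionPts (aC m) (bC m) (Zset m) 0)).extremePoints ℝ := by
    intro p hp
    rw [Finset.coe_image] at hp
    obtain ⟨t, ht, rfl⟩ := hp
    exact vOf_mem_extremePoints m (Finset.mem_coe.1 ht)
  unfold unionVert
  calc 4 * m ^ 4 = ((Idx m).image (vOf m)).card := by rw [Finset.card_image_of_injOn (vOf_injOn m), card_Idx]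
    _ = ((((Idx m).image (vOf m) : Finset (Fin 2 → ℝ)) : Set (Fin 2 → ℝ))).ncard := (Set.ncard_coe_finset _).symm
    _ ≤ _ := Set.ncard_le_ncard hsub hfin

/-- `|G| = 16m³`. -/
theorem card_Grp : Fintype.card (Grp m) = 16 * m ^ 3 := by
  rw [Fintype.card_prod, ZMod.card, ZMod.card]; ring

/-- **The exponent `4/3`**: `|G|⁴ ≤ 1024 · (#vert conv U_0(Z))³` on the family (equality of the two sides' leading terms:
`(16m³)⁴ = 1024·(4m⁴)³`), i.e. the pointwise union vertex count reaches `|G|^{4/3}/10.08`; the tree's EPRS bound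
`…TotalsLawUnionEPRS` caps it at `48|G|^{4/3}`. -/
theorem card_pow_four_le_unionVert_cube :
    Fintype.card (Grp m) ^ 4 ≤ 1024 * unionVert (aC m) (bC m) (Zset m) 0 ^ 3 := by
  have h := four_mul_pow_le_unionVert m
  have h3 : (4 * m ^ 4) ^ 3 ≤ unionVert (aC m) (bC m) (Zset m) 0 ^ 3 := Nat.pow_le_pow_left h 3
  rw [card_Grp]
  calc (16 * m ^ 3) ^ 4 = 1024 * (4 * m ^ 4) ^ 3 := by ring
    _ ≤ 1024 * unionVert (aC m) (bC m) (Zset m) 0 ^ 3 := Nat.mul_le_mul_left _ h3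

end UVBCex

/-- The family beats any prescribed constant: at `m = 4C + 1`, `C·|G| < #vert conv U_0(Z)`. -/
theorem UVBCex.unionVert_gt (C : ℕ) :
    C * Fintype.card (UVBCex.Grp (4 * C + 1)) <
      unionVert (UVBCex.aC (4 * C + 1)) (UVBCex.bC (4 * C + 1)) (UVBCex.Zset (4 * C + 1)) 0 := by
  have h2 := UVBCex.four_mul_pow_le_unionVert (4 * C + 1)
  rw [UVBCex.card_Grp]
  have h3 : 4 * (4 * C + 1) ^ 4 = C * (16 * (4 * C + 1) ^ 3) + 4 * (4 * C + 1) ^ 3 := by ring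
  have h4 : 0 < 4 * (4 * C + 1) ^ 3 := by positivity
  omega

/-- **THE POINTWISE UNION VERTEX BOUND IS FALSE FOR EVERY CONSTANT**: `∀ C, ¬ UnionVertBound C`.  Witness for `C`: the
projective-grid family `UVBCex` at `m = 4C + 1` (`G = ℤ/(2m) × ℤ/(8m²)`, class `0`, position set the anti-parabola), whose
union of fibres has at least `4m⁴ = m·|G|/4 > C·|G|` hull vertices.  (So the located value `C = 3` of
`…TotalsLawUnionVertBound` — census `3q − 1` for `q ≤ 9` — was a small-`q` artefact: the truth is `Θ(|G|^{4/3})`, cf.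
`UVBCex.card_pow_four_le_unionVert_cube` and the EPRS bound of `…TotalsLawUnionEPRS`.) -/
theorem not_unionVertBound (C : ℕ) : ¬ UnionVertBound C := fun h =>
  absurd (h (UVBCex.Grp (4 * C + 1)) (UVBCex.aC (4 * C + 1)) (UVBCex.bC (4 * C + 1)) (UVBCex.Zset (4 * C + 1)) 0)
    (not_le.2 (UVBCex.unionVert_gt C))

/-- Unfolded form: for every `C` there are a finite abelian group `G`, curves `a b`, a position set `Z` and a class `s` with
`#vert conv U_s(Z) > C·|G|`. -/
theorem exists_unionVert_gt (C : ℕ) :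
    ∃ (G : Type) (_ : AddCommGroup G) (_ : Fintype G) (a b : G → (Fin 2 → ℝ)) (Z : Set G) (s : G),
      C * Fintype.card G < unionVert a b Z s :=
  ⟨UVBCex.Grp (4 * C + 1), inferInstance, inferInstance, _, _, _, 0, UVBCex.unionVert_gt C⟩

end TotalsLaw

end Summit.ValiantsHypothesis.ValiantsHypothesis.Theorems.NewtonUnitEquationsDissociatedUniform
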